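import Literature.Probability.LatticeModels.GoodCrossingCaseI
import HarnessLib

/-!
# Transport of the good-crossing estimate from the working level to the axis

Topic `Probability/LatticeModels`; theorems only. `GoodCrossingCaseI.le_measureReal_goodWalk_of_pinning`
works in the upper half-plane `{x₂ ≥ 0}` of a measure `μ'`. To produce the crossing event of
`aizenman_higuchi_of_upperGoodCrossing_bound` — a `∗`-walk of good sites from `(-a, 0)` to `(b, 0)`
avoiding the band `{|z₁| ≤ m, z₂ ≤ m}` — one applies it to the vertically shifted measure
`μ_L = μ ∘ T_L⁻¹`, `(T_L ω)(x) = ω(x + L e₂)`, `L = m + 1` (Georgii–Higuchi 2000 work throughout in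
shifted half-planes `π_{n,up} = θ^n_vert π_up`, §4 and proof of Lemma 5.3), with endpoints `(-a, -L)`,
`(b, -L)` and the shifted band `{|z₁| ≤ m, z₂ ≤ -1}`, and pulls the event back along `T_L × T_L`:

* `prod_map_configShift_comm` — `μ_L ⊗ (μ_L ∘ θ_s⁻¹) = (μ ⊗ (μ ∘ θ_s⁻¹)) ∘ (T_L × T_L)⁻¹`;
* `preimage_goodWalk_configShift` — the pull-back of the level-`0` good-walk event is the good-walk
  event between the shifted endpoints with the shifted constraint;
* **`le_measureReal_upperGoodCrossing_of_level`** — the estimate of `GoodCrossingCaseI` for `μ_L`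
  yields the same lower bound for the `μ ⊗ μ̂`-probability of a good `∗`-crossing from `(-a, 0)` to
  `(b, 0)` avoiding the band `{|z₁| ≤ m, z₂ ≤ m}`.

## References

* H.-O. Georgii, Y. Higuchi, J. Math. Phys. 41 (2000) 1153–1169, §4 (the half-planes `π_{n,up}`)
  and proof of Lemma 5.5, Case 3 [GeorgiiHiguchi2000].
-/

noncomputable section

open MeasureTheory Filter SimpleGraph
open Literature.Probability.Percolation
open scoped ENNReal

namespace Literature.Probability.LatticeModels

section Transport

/-- Translations of configurations commute. [folklore] -/
theorem configShift_comm (u w : Site 2) :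
    (configShift (S := ℤˣ) u : SpinConfig (Site 2) → SpinConfig (Site 2)) ∘ configShift w = configShift w ∘ configShift u := by
  rw [← configShift_add_eq_comp, ← configShift_add_eq_comp, add_comm]

/-- **The duplicated system of the shifted measure is the shifted duplicated system.** [folklore] -/
theorem prod_map_configShift_comm (μ : Measure (SpinConfig (Site 2))) [SFinite μ] (u v : Site 2) :
    (μ.map (configShift v)).prod ((μ.map (configShift v)).map (configShift u)) =
      (μ.prod (μ.map (configShift u))).map (Prod.map (configShift v) (configShift v)) := by
  have hv : Measurable (configShift (S := ℤˣ) v : SpinConfig (Site 2) → SpinConfig (Site 2)) := (configShift v).measurable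
  have hu : Measurable (configShift (S := ℤˣ) u : SpinConfig (Site 2) → SpinConfig (Site 2)) := (configShift u).measurable
  rw [← Measure.map_prod_map _ _ hv hv, Measure.map_map hu hv, Measure.map_map hv hu, configShift_comm]

/-- Shifting a `∗`-walk. [folklore] -/
theorem exists_starWalk_shift {x y : Site 2} (u : Site 2) {P : Site 2 → Prop}
    (h : ∃ w : zdStarGraph.Walk x y, ∀ v ∈ w.support, P v) :
    ∃ w : zdStarGraph.Walk (x + u) (y + u), ∀ v ∈ w.support, P (v - u) := by
  obtain ⟨w, hw⟩ := h
  refine ⟨(w.map (starShiftIso u).toRelEmbedding.toRelHom).copy rfl rfl, fun v hv => ?_⟩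
  rw [Walk.support_copy, Walk.support_map, List.mem_map] at hv
  obtain ⟨z, hz, rfl⟩ := hv
  have : ((starShiftIso u).toRelEmbedding.toRelHom z : Site 2) = z + u := rfl
  rw [this, add_sub_cancel_right]
  exact hw z hz

/-- **Pull-back of the good-walk event along the vertical shift of both layers.** [folklore] -/
theorem preimage_goodWalk_configShift (v x y : Site 2) (Q : Site 2 → Prop) :
    (Prod.map (configShift (S := ℤˣ) v) (configShift (S := ℤˣ) v)) ⁻¹'
        {p : SpinConfig (Site 2) × SpinConfig (Site 2) | ∃ w : zdStarGraph.Walk x y, ∀ z ∈ w.support, p.1 z ≤ p.2 z ∧ Q z} =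
      {p : SpinConfig (Site 2) × SpinConfig (Site 2) | ∃ w : zdStarGraph.Walk (x - v) (y - v),
        ∀ z ∈ w.support, p.1 z ≤ p.2 z ∧ Q (z + v)} := by
  ext p
  simp only [Set.mem_preimage, Set.mem_setOf_eq, Prod.map_fst, Prod.map_snd, configShift_apply]
  constructor
  · intro h
    obtain ⟨w, hw⟩ := exists_starWalk_shift (-v) h
    refine ⟨w.copy (sub_eq_add_neg x v).symm (sub_eq_add_neg y v).symm, fun z hz => ?_⟩
    rw [Walk.support_copy] at hz
    have := hw z hz
    simp only [sub_neg_eq_add] at this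
    rwa [add_sub_cancel_right] at this
  · intro h
    obtain ⟨w, hw⟩ := exists_starWalk_shift v h
    refine ⟨w.copy (sub_add_cancel x v) (sub_add_cancel y v), fun z hz => ?_⟩
    rw [Walk.support_copy] at hz
    have := hw z hz
    rwa [sub_add_cancel] at this

end Transport

section Level

variable {β : ℝ} {μ : Measure (SpinConfig (Site 2))}

/-- **The good-crossing estimate at the axis from the estimate at level `L`**: let
`T = configShift (-L e₂)` (`(T ω)(x) = ω(x + L e₂)`) and `μ_L = μ ∘ T⁻¹`. If the hypotheses of
`le_measureReal_goodWalk_of_pinning` hold for `μ_L` with the endpoints `(-a, -L)`, `(b, -L)` and the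
constraint `Q z = ¬(|z₁| ≤ m ∧ z₂ ≤ -1)`, where `L = m + 1`, then with `μ ⊗ μ̂`-probability at least
`c₀ c_P²` there is a `∗`-walk of good sites from `(-a, 0)` to `(b, 0)` avoiding the band
`{|z₁| ≤ m, z₂ ≤ m}` — the event of `aizenman_higuchi_of_upperGoodCrossing_bound`. [cite: GeorgiiHiguchi2000, Lemma 5.5 (proof, Case 3, p. 15)] -/
theorem le_measureReal_upperGoodCrossing_of_level (hβc : criticalBeta 2 < β) (hμ : μ ∈ isingGibbsMeasures 2 β 0)
    (hμt : IsTailTrivial μ) (s : ℤˣ) (m : ℕ) (a b : ℤ) {cP : ℝ} (hcP : 0 ≤ cP)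
    (hL : ∀ᵐ ω ∂(μ.map (configShift (-((m + 1 : ℕ) : ℤ) • (Pi.single 1 1 : Site 2)))),
      ∃ x, ∀ n : ℕ, ∃ k : ℤ, k < -(n : ℤ) ∧ (![k, 0] : Site 2) ∈ siteCluster zdStarGraph (spinSites 1 ω ∩ halfPlane 0) x)
    (hC : ∀ᵐ ω ∂(μ.map (configShift (-((m + 1 : ℕ) : ℤ) • (Pi.single 1 1 : Site 2)))),
      ∃ y, (siteCluster (zdGraph 2) (spinSites (-1) ω ∩ halfPlane 0) y).Infinite)
    (hpinx : cP ≤ ((μ.map (configShift (-((m + 1 : ℕ) : ℤ) • (Pi.single 1 1 : Site 2)))).map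
        (configShift (Pi.single 0 (s : ℤ)))).real
      {ω : SpinConfig (Site 2) | ∃ z, (siteCluster zdStarGraph (spinSites 1 ω ∩ halfPlane 0) z).Infinite ∧
        ∃ w : zdStarGraph.Walk (![-a, -((m + 1 : ℕ) : ℤ)]) z, ∀ v ∈ w.support,
          ω v = 1 ∧ ¬ (-(m : ℤ) ≤ v 0 ∧ v 0 ≤ m ∧ v 1 ≤ -1)})
    (hpiny : cP ≤ (μ.map (configShift (-((m + 1 : ℕ) : ℤ) • (Pi.single 1 1 : Site 2)))).real
      {ω : SpinConfig (Site 2) | ∃ z, (siteCluster (zdGraph 2) (spinSites (-1) ω ∩ halfPlane 0) z).Infinite ∧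
        ∃ w : zdStarGraph.Walk (![b, -((m + 1 : ℕ) : ℤ)]) z, ∀ v ∈ w.support,
          ω v = -1 ∧ ¬ (-(m : ℤ) ≤ v 0 ∧ v 0 ≤ m ∧ v 1 ≤ -1)}) :
    ((1 - (1 + ENNReal.ofReal (Real.exp (-(8 * |β|)) / 2))⁻¹) / 2).toReal * cP * cP ≤
      (μ.prod (μ.map (configShift (Pi.single 0 (s : ℤ))))).real
        {p : SpinConfig (Site 2) × SpinConfig (Site 2) | ∃ w : zdStarGraph.Walk (![-a, 0]) (![b, 0]),
          ∀ z ∈ w.support, p.1 z ≤ p.2 z ∧ ¬ (-(m : ℤ) ≤ z 0 ∧ z 0 ≤ m ∧ z 1 ≤ m)} := by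
  have hμG : IsGibbsMeasure (isingSpecification (zdGraph 2) β 0) μ := hμ
  haveI := hμG.isProbabilityMeasure
  set L : ℕ := m + 1 with hLdef
  set vL : Site 2 := -((L : ℕ) : ℤ) • (Pi.single 1 1 : Site 2) with hvL
  set T : SpinConfig (Site 2) → SpinConfig (Site 2) := ⇑(configShift (S := ℤˣ) vL) with hT
  have hTm : Measurable T := (configShift _).measurable
  set μL : Measure (SpinConfig (Site 2)) := μ.map T with hμL
  have hμLG : μL ∈ isingGibbsMeasures 2 β 0 := mem_isingGibbsMeasures_map_configShift hμ _
  have hμLt : IsTailTrivial μL := hμt.map_configRelabel (Site.shift _)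
  -- the constraint at level `0` is satisfied on the closed upper half-plane
  have hQ : ∀ v : Site 2, 0 ≤ v 1 → ¬ (-(m : ℤ) ≤ v 0 ∧ v 0 ≤ m ∧ v 1 ≤ -1) := fun v hv h => by omega
  have key := le_measureReal_goodWalk_of_pinning hβc hμLG hμLt s hL hC hQ (![-a, -((m + 1 : ℕ) : ℤ)]) (![b, -((m + 1 : ℕ) : ℤ)])
    hpinx hpiny hcP
  -- pull back along `T × T`
  have hθm : Measurable (configShift (S := ℤˣ) (Pi.single (0 : Fin 2) (s : ℤ)) : SpinConfig (Site 2) → SpinConfig (Site 2)) :=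
    (configShift _).measurable
  have hprod := prod_map_configShift_comm μ (Pi.single (0 : Fin 2) (s : ℤ)) vL
  have hset : MeasurableSet {p : SpinConfig (Site 2) × SpinConfig (Site 2) |
      ∃ w : zdStarGraph.Walk (![-a, -((m + 1 : ℕ) : ℤ)]) (![b, -((m + 1 : ℕ) : ℤ)]),
        ∀ z ∈ w.support, p.1 z ≤ p.2 z ∧ ¬ (-(m : ℤ) ≤ z 0 ∧ z 0 ≤ m ∧ z 1 ≤ -1)} := measurableSet_goodCrossing _ _ _
  rw [measureReal_def, hprod, Measure.map_apply (hTm.prodMap hTm) hset, preimage_goodWalk_configShift] at key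
  -- identify the endpoints and the constraint
  have hx : (![-a, -((m + 1 : ℕ) : ℤ)] : Site 2) - vL = ![-a, 0] := by
    rw [hvL]; ext i; fin_cases i <;> simp [hLdef]
  have hy : (![b, -((m + 1 : ℕ) : ℤ)] : Site 2) - vL = ![b, 0] := by
    rw [hvL]; ext i; fin_cases i <;> simp [hLdef]
  have hQ' : ∀ z : Site 2, (¬ (-(m : ℤ) ≤ (z + vL) 0 ∧ (z + vL) 0 ≤ m ∧ (z + vL) 1 ≤ -1)) ↔
      ¬ (-(m : ℤ) ≤ z 0 ∧ z 0 ≤ m ∧ z 1 ≤ m) := fun z => by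
    rw [hvL]; simp [hLdef]; omega
  rw [measureReal_def]
  convert key using 3
  ext p
  simp only [Set.mem_setOf_eq]
  rw [hx, hy]
  constructor
  · rintro ⟨w, hw⟩; exact ⟨w, fun z hz => ⟨(hw z hz).1, (hQ' z).2 (hw z hz).2⟩⟩
  · rintro ⟨w, hw⟩; exact ⟨w, fun z hz => ⟨(hw z hz).1, (hQ' z).1 (hw z hz).2⟩⟩

end Level

end Literature.Probability.LatticeModels
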